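import Mathlib.Analysis.Normed.Group.Basic
import Mathlib.Algebra.Order.BigOperators.Group.Finset
import Mathlib.Algebra.BigOperators.Ring.Finset
import HarnessLib

/-!
# Ventures/CertifiedQuantumChemistry — Rows/SweepErrorBudget.lean: the a-priori/a-posteriori error budget of a
# left-to-right tensor-network sweep (the THEOREM of FORMAT-qcmps0 §4 behind lineages A1 / B2 / B3)

HONEST FRAMING (verbatim): certified bounds for a stated model Hamiltonian in a stated basis; not a
claim about the real molecule beyond that model.

var-2 (gen 5), zero compute, PROVED glue only (0 sorry, no definition, no claim node, nothing here asserts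
a bound about any model). The MPS upper certificates (`qc-upper-v0`, FORMAT-qcmps0 §4) enclose
`⟨ψ|H_F|ψ⟩` by evaluating the environment recursion `L_{b+1} = Φ_b(L_b)` in floating point: the
COMPUTED environments `L̂_b` satisfy a per-site LOCAL error bound `‖L̂_{b+1}[y] − Φ_b(L̂_b)[y]‖ ≤ ρ_b[y]`
(obtained per lineage: A1 from a γ_n rounding model, B2 from Arb radii, B3 from error-free split
products), and `Φ_b` is Lipschitz per output state with the weights
`‖Φ_b(L)[y] − Φ_b(L')[y]‖ ≤ Σ_x K_b[x,y] ‖L[x] − L'[x]‖`, `K_b[x,y] = κ_b ‖O_b[x,y]‖₂ ≥ 0`. The budget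
`e_{b+1}[y] ≥ Σ_x K_b[x,y] e_b[x] + ρ_b[y]`, `e_0 ≥ ‖L̂_0 − L_0‖`, then dominates the GLOBAL error at every
bond: `‖L̂_n[y] − L_n[y]‖ ≤ e_n[y]` — in particular at the last bond `|L̂_k[END] − ⟨ψ|O|ψ⟩| ≤ e_k[END]`.
This file is that induction, stated over arbitrary seminormed groups `V b` (the environment block spaces)
and finite index types `W b` (the MPO bond states), so that it is literally the inequality the three
lineages instantiate; the per-lineage facts (the values of `ρ`, `K`) are established outside the kernel by
the cell's readers, exactly as for every other certificate. Reference: Higham, ASNA (2002) §3.1 (running /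
a-priori error recursions); qcmps `contract_nb.py` docstring (THEOREM), `contract_eft.py` (P1)–(P5).
-/

namespace Summit.Ventures.CertifiedQuantumChemistry

open Finset

/-- **Scalar sweep error budget.** A chain of maps `Φ b : X b → X (b+1)` between (pseudo)metric spaces,
each `K b`-Lipschitz in the sense `dist (Φ b u) (Φ b v) ≤ K b * dist u v` with `0 ≤ K b`; exact iterates
`x (b+1) = Φ b (x b)`; computed iterates `xh` with local errors `dist (xh (b+1)) (Φ b (xh b)) ≤ ρ b`; a
budget `e` with `dist (xh 0) (x 0) ≤ e 0` and `K b * e b + ρ b ≤ e (b+1)`. Then `dist (xh n) (x n) ≤ e n`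
for every `n`. -/
theorem sweep_dist_le_budget {X : ℕ → Type*} [∀ b, PseudoMetricSpace (X b)]
    (Φ : ∀ b, X b → X (b + 1)) (K ρ e : ℕ → ℝ) (hK : ∀ b, 0 ≤ K b)
    (hΦ : ∀ b (u v : X b), dist (Φ b u) (Φ b v) ≤ K b * dist u v)
    (x xh : ∀ b, X b) (hx : ∀ b, x (b + 1) = Φ b (x b))
    (hloc : ∀ b, dist (xh (b + 1)) (Φ b (xh b)) ≤ ρ b)
    (he0 : dist (xh 0) (x 0) ≤ e 0) (he : ∀ b, K b * e b + ρ b ≤ e (b + 1)) :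
    ∀ n, dist (xh n) (x n) ≤ e n := by
  intro n
  induction n with
  | zero => exact he0
  | succ b ih =>
    calc dist (xh (b + 1)) (x (b + 1))
        ≤ dist (xh (b + 1)) (Φ b (xh b)) + dist (Φ b (xh b)) (x (b + 1)) := dist_triangle _ _ _
      _ ≤ ρ b + K b * dist (xh b) (x b) := by
          rw [hx b]; exact add_le_add (hloc b) (hΦ b _ _)
      _ ≤ ρ b + K b * e b := by gcongr; exact hK b
      _ ≤ e (b + 1) := by linarith [he b]

/-- **Sweep error budget, per MPO bond state (FORMAT-qcmps0 §4 THEOREM).** Environments are families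
`W b → V b` (one block `L_b[x]` per MPO bond state `x`, in a seminormed group `V b`); the site map `Φ b`
satisfies the weighted Lipschitz estimate `‖Φ b L y − Φ b L' y‖ ≤ Σ_x K b x y * ‖L x − L' x‖` with
`0 ≤ K b x y` (`K_b[x,y] = κ_b ‖O_b[x,y]‖₂` in the cell's instance); exact `L (b+1) = Φ b (L b)`; computed
`Lh` with local errors `‖Lh (b+1) y − Φ b (Lh b) y‖ ≤ ρ b y`; budget `e` with `‖Lh 0 x − L 0 x‖ ≤ e 0 x` and
`Σ_x K b x y * e b x + ρ b y ≤ e (b+1) y`. Then `‖Lh n y − L n y‖ ≤ e n y` for all `n, y`. -/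
theorem sweep_norm_sub_le_budget {W : ℕ → Type*} [∀ b, Fintype (W b)] {V : ℕ → Type*}
    [∀ b, SeminormedAddCommGroup (V b)]
    (Φ : ∀ b, (W b → V b) → (W (b + 1) → V (b + 1))) (K : ∀ b, W b → W (b + 1) → ℝ)
    (hK : ∀ b x y, 0 ≤ K b x y)
    (hΦ : ∀ b (L L' : W b → V b) (y : W (b + 1)), ‖Φ b L y - Φ b L' y‖ ≤ ∑ x, K b x y * ‖L x - L' x‖)
    (L Lh : ∀ b, W b → V b) (hL : ∀ b, L (b + 1) = Φ b (L b)) (ρ : ∀ b, W (b + 1) → ℝ) (e : ∀ b, W b → ℝ)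
    (hloc : ∀ b y, ‖Lh (b + 1) y - Φ b (Lh b) y‖ ≤ ρ b y) (he0 : ∀ x, ‖Lh 0 x - L 0 x‖ ≤ e 0 x)
    (he : ∀ b y, (∑ x, K b x y * e b x) + ρ b y ≤ e (b + 1) y) :
    ∀ n y, ‖Lh n y - L n y‖ ≤ e n y := by
  intro n
  induction n with
  | zero => exact he0
  | succ b ih =>
    intro y
    have h1 : ‖Lh (b + 1) y - L (b + 1) y‖
        ≤ ‖Lh (b + 1) y - Φ b (Lh b) y‖ + ‖Φ b (Lh b) y - Φ b (L b) y‖ := by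
      rw [hL b]; exact norm_sub_le_norm_sub_add_norm_sub _ _ _
    have h2 : ‖Φ b (Lh b) y - Φ b (L b) y‖ ≤ ∑ x, K b x y * e b x :=
      (hΦ b _ _ y).trans (sum_le_sum fun x _ => mul_le_mul_of_nonneg_left (ih x) (hK b x y))
    linarith [hloc b y, he b y]

/-- The END-of-chain form used by the certificates: with the hypotheses of
`sweep_norm_sub_le_budget`, the last bond's computed scalar block is within its budget of the exact
contraction: `‖Lh k y − L k y‖ ≤ e k y` (instantiate `n := k`, `y := END`). -/
theorem sweep_norm_sub_le_budget_last {W : ℕ → Type*} [∀ b, Fintype (W b)] {V : ℕ → Type*}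
    [∀ b, SeminormedAddCommGroup (V b)]
    (Φ : ∀ b, (W b → V b) → (W (b + 1) → V (b + 1))) (K : ∀ b, W b → W (b + 1) → ℝ)
    (hK : ∀ b x y, 0 ≤ K b x y)
    (hΦ : ∀ b (L L' : W b → V b) (y : W (b + 1)), ‖Φ b L y - Φ b L' y‖ ≤ ∑ x, K b x y * ‖L x - L' x‖)
    (L Lh : ∀ b, W b → V b) (hL : ∀ b, L (b + 1) = Φ b (L b)) (ρ : ∀ b, W (b + 1) → ℝ) (e : ∀ b, W b → ℝ)
    (hloc : ∀ b y, ‖Lh (b + 1) y - Φ b (Lh b) y‖ ≤ ρ b y) (he0 : ∀ x, ‖Lh 0 x - L 0 x‖ ≤ e 0 x)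
    (he : ∀ b y, (∑ x, K b x y * e b x) + ρ b y ≤ e (b + 1) y) (k : ℕ) (yEnd : W k) :
    ‖Lh k yEnd - L k yEnd‖ ≤ e k yEnd :=
  sweep_norm_sub_le_budget Φ K hK hΦ L Lh hL ρ e hloc he0 he k yEnd

end Summit.Ventures.CertifiedQuantumChemistry
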